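import Summits.ResolutionOfSingularities.ResolutionOfSingularities.Theorems.EquisingularLiftEquisingularLiftNatDepthClosedPoints
import HarnessLib

/-!
# [OURS] BLOW-UP TOWERS EXIST (the depth framework is not vacuous) — and the `∃ x ∀ D` form of the isolated-residual description
# (cruxes `Theses.EquisingularLift.EquisingularLiftNat` / `…NatThree`, stmt-ResolutionOfSingularities-20038 / -20148)

[OURS · leafhand-res-equisingularlift-10 g1, 2026-08-31; cell `pub/decomp-res`] AI-produced, weaker than expert review; NOT a statement of any manuscript;
nothing here proves resolution of singularities in positive characteristic.  DEF-FREE helper; no `sorry`; standard axioms; ZERO named hypotheses.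

The tower theorems (✓ p831323 … p831547) quantify over families `D` satisfying the recursion `hD0` / `hDsucc` («blow-up towers»), never defining one.  Here:

* ★★ `exists_blowupTower` — **a blow-up tower EXISTS** (the intrinsic tower by primitive recursion on the level with payload «previous level», which is
  equivalent to «some level `≤ d`» by monotonicity) — so every `∀ D, tower D → …` statement of the framework is non-vacuous, and by ✓ `tower_unique` all
  towers agree at closed points;
* ★★★ `exists_nonRegular_forall_tower_infinite_depth` — **`k = k̄`, `H` integral, `ι : H ↪ ℙⁿ_k` a closed immersion, FINITE non-regular locus, `¬ IsoHypPoint`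
  ⟹ there is ONE non-regular (closed) point `x` of `H` which has infinite depth in EVERY blow-up tower** (`∃ x ∀ D`, from ✓ `exists_nonRegular_of_infinite_depth`
  for the tower of `exists_blowupTower`, then ✓ `tower_unique` at the closed point `x`, closed by ✓ `isClosed_singleton_of_finite_nonRegularLocus`).

Honest label: closes no registered stub; final form of the repair-census datum «the isolated residual = a singular point surviving, over itself, every finite
number of rounds of closed-point blow-ups».

References: [StacksProject, Tags 080E, 02OS]; [Hartshorne1977, II Ex. 7.12, V 3.9]; [Matsumura1987, Thm. 30.5] — through the cited tree files.
-/

set_option linter.dupNamespace false -- mandated namespace `Summit.<Summit>.<Problem>` of this single-conjunct summit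

noncomputable section

open CategoryTheory CategoryTheory.Limits AlgebraicGeometry TopologicalSpace
open Literature.AlgebraicGeometry.Resolution Literature.AlgebraicGeometry.Motives
open AlgebraicGeometry.Scheme.IdealSheafData

namespace Summit.ResolutionOfSingularities.ResolutionOfSingularities.Cruxes.EquisingularLiftNat.Sections

/-- ★★ **BLOW-UP TOWERS EXIST.**  The family `T` defined by primitive recursion — `T 0` = one-step; `T (d+1) Γ y` = «every blow-up of `Γ` at the closed point
`y` is regular over `y` except at finitely many closed points `z` with `T d Z z`» — is MONOTONE in the level, hence satisfies the tower recursion `hD0` / `hDsucc`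
(payload «some level `≤ d`»).  [OURS] -/
theorem exists_blowupTower : ∃ D : ℕ → ∀ Γ : Scheme.{0}, Γ → Prop,
    (∀ (Γ : Scheme.{0}) (y : Γ), IsClosed (({y} : Set Γ)) →
      (D 0 Γ y ↔ ∀ (hy : IsClosed (({y} : Set Γ))) (Z : Scheme.{0}) (τ : Z ⟶ Γ), IsBlowup τ (vanishingIdeal ⟨{y}, hy⟩) →
        ∀ z : Z, τ z = y → IsRegularLocalRing (Z.presheaf.stalk z))) ∧
    (∀ (d : ℕ) (Γ : Scheme.{0}) (y : Γ), IsClosed (({y} : Set Γ)) →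
      (D (d + 1) Γ y ↔ ∀ (hy : IsClosed (({y} : Set Γ))) (Z : Scheme.{0}) (τ : Z ⟶ Γ), IsBlowup τ (vanishingIdeal ⟨{y}, hy⟩) →
        ∃ S' : Finset Z, (∀ z : Z, τ z = y → z ∉ S' → IsRegularLocalRing (Z.presheaf.stalk z)) ∧
          ∀ z ∈ S', τ z = y ∧ IsClosed (({z} : Set Z)) ∧ ∃ d' ≤ d, D d' Z z)) := by
  let T : ℕ → ∀ Γ : Scheme.{0}, Γ → Prop := fun d =>
    Nat.rec (motive := fun _ => ∀ Γ : Scheme.{0}, Γ → Prop)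
      (fun Γ y => ∀ (hy : IsClosed (({y} : Set Γ))) (Z : Scheme.{0}) (τ : Z ⟶ Γ), IsBlowup τ (vanishingIdeal ⟨{y}, hy⟩) →
        ∀ z : Z, τ z = y → IsRegularLocalRing (Z.presheaf.stalk z))
      (fun _ Td Γ y => ∀ (hy : IsClosed (({y} : Set Γ))) (Z : Scheme.{0}) (τ : Z ⟶ Γ), IsBlowup τ (vanishingIdeal ⟨{y}, hy⟩) →
        ∃ S' : Finset Z, (∀ z : Z, τ z = y → z ∉ S' → IsRegularLocalRing (Z.presheaf.stalk z)) ∧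
          ∀ z ∈ S', τ z = y ∧ IsClosed (({z} : Set Z)) ∧ Td Z z) d
  have h0 : ∀ (Γ : Scheme.{0}) (y : Γ), T 0 Γ y ↔ ∀ (hy : IsClosed (({y} : Set Γ))) (Z : Scheme.{0}) (τ : Z ⟶ Γ), IsBlowup τ (vanishingIdeal ⟨{y}, hy⟩) →
        ∀ z : Z, τ z = y → IsRegularLocalRing (Z.presheaf.stalk z) := fun Γ y => Iff.rfl
  have hs : ∀ (d : ℕ) (Γ : Scheme.{0}) (y : Γ), T (d + 1) Γ y ↔ ∀ (hy : IsClosed (({y} : Set Γ))) (Z : Scheme.{0}) (τ : Z ⟶ Γ), IsBlowup τ (vanishingIdeal ⟨{y}, hy⟩) →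
        ∃ S' : Finset Z, (∀ z : Z, τ z = y → z ∉ S' → IsRegularLocalRing (Z.presheaf.stalk z)) ∧
          ∀ z ∈ S', τ z = y ∧ IsClosed (({z} : Set Z)) ∧ T d Z z := fun d Γ y => Iff.rfl
  -- monotonicity in the level
  have mono : ∀ (d : ℕ) (Γ : Scheme.{0}) (y : Γ), T d Γ y → T (d + 1) Γ y := by
    intro d
    induction d with
    | zero =>
      intro Γ y h
      refine (hs 0 Γ y).mpr ?_
      intro hy Z τ hτ
      exact ⟨∅, fun z hz _ => (h0 Γ y).mp h hy Z τ hτ z hz, fun z hz => absurd hz (Finset.notMem_empty z)⟩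
    | succ d ih =>
      intro Γ y h
      refine (hs (d + 1) Γ y).mpr ?_
      have h' := (hs d Γ y).mp h
      intro hy Z τ hτ
      obtain ⟨S', hreg, hS'⟩ := h' hy Z τ hτ
      refine ⟨S', hreg, fun z hz => ?_⟩
      obtain ⟨hτz, hzcl, hT⟩ := hS' z hz
      exact ⟨hτz, hzcl, ih Z z hT⟩
  have mono' : ∀ (d' d : ℕ), d' ≤ d → ∀ (Γ : Scheme.{0}) (y : Γ), T d' Γ y → T d Γ y := by
    intro d' d hle Γ y h
    induction hle with
    | refl => exact h
    | step _ ih => exact mono _ Γ y ih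
  refine ⟨T, fun Γ y _ => h0 Γ y, fun d Γ y _ => (hs d Γ y).trans ?_⟩
  refine forall_congr' fun hy => forall_congr' fun Z => forall_congr' fun τ => forall_congr' fun _ => exists_congr fun S' =>
    and_congr_right fun _ => forall_congr' fun z => forall_congr' fun _ => and_congr_right fun _ => and_congr_right fun _ => ?_
  exact ⟨fun h => ⟨d, le_rfl, h⟩, fun ⟨d', hd', h⟩ => mono' d' d hd' Z z h⟩

/-- ★★★ **FINITE NON-REGULAR LOCUS + `¬ IsoHypPoint` ⟹ ONE NON-REGULAR POINT OF INFINITE DEPTH IN EVERY BLOW-UP TOWER** (`∃ x ∀ D`).  `k = k̄`, `H` integral,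
`ι : H ↪ ℙⁿ_k` a closed immersion, `{x | 𝒪_{H,x} not regular}` finite, `¬ IsoHypPoint k n H ι`: there is a non-regular closed point `x` of `H` such that for every
blow-up tower `D` and every level `d`, `¬ D d H x`. [OURS] [cite: StacksProject, Tag 080E] [cite: Matsumura1987, Thm. 30.5] -/
theorem exists_nonRegular_forall_tower_infinite_depth (k : Type) [Field k] [IsAlgClosed k] (n : ℕ) (H : Scheme.{0})
    (ι : H ⟶ (projectiveSpace n k).left) [IsClosedImmersion ι] [IsIntegral H]
    (hfin : Set.Finite {x : H | ¬ IsRegularLocalRing (H.presheaf.stalk x)})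
    (hnot : ¬ IsoHypPoint k n H ι) :
    ∃ x : H, ¬ IsRegularLocalRing (H.presheaf.stalk x) ∧ IsClosed (({x} : Set H)) ∧
      ∀ D : ℕ → ∀ Γ : Scheme.{0}, Γ → Prop,
        (∀ (Γ : Scheme.{0}) (y : Γ), IsClosed (({y} : Set Γ)) →
          (D 0 Γ y ↔ ∀ (hy : IsClosed (({y} : Set Γ))) (Z : Scheme.{0}) (τ : Z ⟶ Γ), IsBlowup τ (vanishingIdeal ⟨{y}, hy⟩) →
            ∀ z : Z, τ z = y → IsRegularLocalRing (Z.presheaf.stalk z))) ∧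
        (∀ (d : ℕ) (Γ : Scheme.{0}) (y : Γ), IsClosed (({y} : Set Γ)) →
          (D (d + 1) Γ y ↔ ∀ (hy : IsClosed (({y} : Set Γ))) (Z : Scheme.{0}) (τ : Z ⟶ Γ), IsBlowup τ (vanishingIdeal ⟨{y}, hy⟩) →
            ∃ S' : Finset Z, (∀ z : Z, τ z = y → z ∉ S' → IsRegularLocalRing (Z.presheaf.stalk z)) ∧
              ∀ z ∈ S', τ z = y ∧ IsClosed (({z} : Set Z)) ∧ ∃ d' ≤ d, D d' Z z)) →
        ∀ d : ℕ, ¬ D d H x := by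
  obtain ⟨T, hT0, hTs⟩ := exists_blowupTower
  obtain ⟨x, hx, hxT⟩ := exists_nonRegular_of_infinite_depth k n H ι T hT0 hTs hfin hnot
  have hxcl : IsClosed (({x} : Set H)) := isClosed_singleton_of_finite_nonRegularLocus (ι ≫ (projectiveSpace n k).hom) hfin x hx
  refine ⟨x, hx, hxcl, fun D hD d hD' => hxT d ?_⟩
  exact (tower_unique D hD.1 hD.2 T hT0 hTs d H x hxcl).mp hD'

end Summit.ResolutionOfSingularities.ResolutionOfSingularities.Cruxes.EquisingularLiftNat.Sections

end
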